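import Summits.ValiantsHypothesis.ValiantsHypothesis.Theorems.LacunarySymmetroidMatrixDescartesCensusTwistedRolleMult
import Literature.Algebra.Polynomial.DescartesSignVariations

/-!
# `MatrixDescartes` census — counting positive roots by sign changes, and SPLITTING A DOUBLE ROOT inside a class

HONEST FRAMING.  Object-search cell `pub-symmetroid`, route `LacunarySymmetroid`; tools for the V = 19 layer of door A
(`Theses.LacunarySymmetroid.DoorA26` = stmt-ValiantsHypothesis-19979, `DoorA34` = stmt-19980).  Elementary theorems about
ONE real polynomial, in the tree's two currencies `#Z₊^{distinct}(f) = #(f.roots.toFinset.filter (0<·))` and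
`#Z₊^{mult}(f) = f.roots.countP (0<·)`:

* `mul_eval_neg_of_rootMultiplicity_eq_one` — a SIMPLE root which is the only root in `[a, b]` is a strict sign change
  `f(a)·f(b) < 0` (the even-multiplicity companion is `Literature…Descartes.mul_eval_nonneg_of_even_rootMultiplicity`);
* `card_le_card_posRoots_of_signChanges` — a finite family of pairwise SEPARATED sign-change intervals in `(0, ∞)`
  counts distinct positive roots (intermediate value theorem; the interval-family form of the tree's
  `le_card_posRoots_of_alternating`);
* `exists_card_posRoots_of_double_root_deformation` — **DOUBLE-ROOT SPLITTING INSIDE A CLASS `P`.**  If `f ∈ P` has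
  `≥ N` distinct positive roots and EXACTLY `N + 1` counted with multiplicity, and every positive double root `r` of `f`
  can be pushed to either prescribed sign by a deformation `ε ↦ g ε ∈ P` converging to `f` pointwise as `ε → 0⁺`,
  then some member of `P` has `≥ N + 1` distinct positive roots.  (Either `f` already has them, or exactly one of its
  `N` positive roots is double and the rest are simple; along `2N + 1` test points — one in each gap, plus the double
  root itself — a small deformation shows `N + 1` sign changes.)  This is the polynomial half of the door-A sub-case
  (A′) «alternating nineteen ⇒ twenty on the same support» (companion file `…CensusNineteenLift.lean`, class `P` =
  determinants of symmetric `2 × 2` pencils on a fixed exponent vector); it is stated for a general class so that the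
  `(3,4)` door can use it verbatim (`N = 18`, `3 × 3` letters).

Nothing here bears on `ζ_sym`, on `DoorA26`/`DoorA34` (OPEN, never asserted), on `MatrixDescartes`
(stmt-ValiantsHypothesis-18050) or on `VP ≠ VNP`.

[folklore] Intermediate value theorem; «a double root splits under a transversal deformation».
-/

-- `Summit.ValiantsHypothesis.ValiantsHypothesis.…` repeats a component by the D-0017 layout
-- (single-conjunct summit), which the `dupNamespace` linter flags; the name is mandated.
set_option linter.dupNamespace false

namespace Summit.ValiantsHypothesis.ValiantsHypothesis.Theorems.LacunarySymmetroidMatrixDescartes.Census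

open Polynomial Finset Filter
open scoped BigOperators Polynomial Topology

/-! ### Sign changes and root counting -/

/-- A SIMPLE root `r` which is the only root of `f` in `[a, b]` (`a < r < b`) is a strict sign change:
`f(a) · f(b) < 0`. [folklore] -/
theorem mul_eval_neg_of_rootMultiplicity_eq_one {f : ℝ[X]} {a b r : ℝ} (har : a < r) (hrb : r < b)
    (hm : f.rootMultiplicity r = 1) (honly : ∀ z ∈ Set.Icc a b, f.IsRoot z → z = r) :
    f.eval a * f.eval b < 0 := by
  have hf : f ≠ 0 := by
    intro h; rw [h, rootMultiplicity_zero] at hm; exact zero_ne_one hm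
  obtain ⟨g, hfg, hg⟩ := f.exists_eq_pow_rootMultiplicity_mul_and_not_dvd hf r
  rw [hm, pow_one] at hfg
  have hgr : g.eval r ≠ 0 := fun h0 => hg (dvd_iff_isRoot.mpr h0)
  have hgz : ∀ z ∈ Set.Icc a b, g.eval z ≠ 0 := by
    intro z hz h0
    have hfz : f.IsRoot z := by rw [IsRoot, hfg, eval_mul, h0, mul_zero]
    rw [honly z hz hfz] at h0
    exact hgr h0
  have hgab := Literature.Algebra.Polynomial.Descartes.mul_eval_pos_of_forall_ne_zero (har.trans hrb).le hgz
  have ha : f.eval a = (a - r) * g.eval a := by rw [hfg, eval_mul, eval_sub, eval_X, eval_C]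
  have hb : f.eval b = (b - r) * g.eval b := by rw [hfg, eval_mul, eval_sub, eval_X, eval_C]
  rw [ha, hb, show (a - r) * g.eval a * ((b - r) * g.eval b) = ((a - r) * (b - r)) * (g.eval a * g.eval b) by ring]
  exact mul_neg_of_neg_of_pos (mul_neg_of_neg_of_pos (by linarith) (by linarith)) hgab

/-- **Counting distinct positive roots by separated sign changes.**  If `I` is a finite family of pairs `(a, b)`,
`0 < a < b`, with `f(a) · f(b) < 0`, and any two distinct pairs are separated (`b ≤ a'` or `b' ≤ a`), then `f` has at
least `#I` distinct positive roots (one in each open interval, by the intermediate value theorem). [folklore] -/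
theorem card_le_card_posRoots_of_signChanges (f : ℝ[X]) (I : Finset (ℝ × ℝ))
    (hI : ∀ p ∈ I, 0 < p.1 ∧ p.1 < p.2 ∧ f.eval p.1 * f.eval p.2 < 0)
    (hdisj : ∀ p ∈ I, ∀ q ∈ I, p ≠ q → p.2 ≤ q.1 ∨ q.2 ≤ p.1) :
    I.card ≤ (f.roots.toFinset.filter (fun t => 0 < t)).card := by
  classical
  rcases I.eq_empty_or_nonempty with h0 | ⟨p0, hp0⟩
  · simp [h0]
  have hf : f ≠ 0 := by
    rintro rfl
    have := (hI p0 hp0).2.2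
    simp at this
  have hroot : ∀ p ∈ I, ∃ x, p.1 < x ∧ x < p.2 ∧ f.IsRoot x := by
    intro p hp
    obtain ⟨-, hlt, hneg⟩ := hI p hp
    have hcont : ContinuousOn (fun x => f.eval x) (Set.Icc p.1 p.2) := f.continuous.continuousOn
    rcases mul_neg_iff.1 hneg with ⟨h1, h2⟩ | ⟨h1, h2⟩
    · obtain ⟨x, ⟨hx1, hx2⟩, hx⟩ := intermediate_value_Ioo' hlt.le hcont ⟨h2, h1⟩
      exact ⟨x, hx1, hx2, hx⟩
    · obtain ⟨x, ⟨hx1, hx2⟩, hx⟩ := intermediate_value_Ioo hlt.le hcont ⟨h1, h2⟩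
      exact ⟨x, hx1, hx2, hx⟩
  choose! g hg using hroot
  have hmaps : Set.MapsTo g I (f.roots.toFinset.filter (fun t => 0 < t)) := by
    intro p hp
    obtain ⟨h1, -, h3⟩ := hg p hp
    have : g p ∈ f.roots.toFinset.filter (fun t => 0 < t) := by
      rw [Finset.mem_filter, Multiset.mem_toFinset, mem_roots hf]
      exact ⟨h3, (hI p hp).1.trans h1⟩
    exact this
  have hinj : Set.InjOn g I := by
    intro p hp q hq hpq
    by_contra hne
    obtain ⟨hp1, hp2, -⟩ := hg p hp
    obtain ⟨hq1, hq2, -⟩ := hg q hq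
    rcases hdisj p hp q hq hne with h | h
    · rw [hpq] at hp2; linarith
    · rw [hpq] at hp1; linarith
  exact Finset.card_le_card_of_injOn g hmaps hinj

/-! ### Splitting a double root inside a class -/

/-- **DOUBLE-ROOT SPLITTING INSIDE A CLASS.**  Let `P` be any class of real polynomials and `f ∈ P` with at least `N`
distinct positive roots and exactly `N + 1` positive roots counted with multiplicity.  Suppose every positive root `r`
of `f` of multiplicity `2` can be «pushed to either side inside `P`»: for every `σ ≠ 0` there is a deformation
`g : ℝ → ℝ[X]` with `g ε ∈ P`, `(g ε)(x) → f(x)` as `ε → 0⁺` for every `x`, and `(g ε)(r) · σ < 0` for all small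
`ε > 0`.  Then some member of `P` has at least `N + 1` distinct positive roots. [folklore] -/
theorem exists_card_posRoots_of_double_root_deformation (P : ℝ[X] → Prop) (f : ℝ[X]) (N : ℕ) (hPf : P f)
    (hZ : N ≤ (f.roots.toFinset.filter (fun t => 0 < t)).card)
    (hZm : f.roots.countP (fun t => 0 < t) = N + 1)
    (hdef : ∀ r : ℝ, 0 < r → f.rootMultiplicity r = 2 → ∀ σ : ℝ, σ ≠ 0 →
      ∃ g : ℝ → ℝ[X], (∀ ε, P (g ε)) ∧
        (∀ x, Tendsto (fun ε => (g ε).eval x) (𝓝[>] 0) (𝓝 (f.eval x))) ∧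
        ∀ᶠ ε in 𝓝[>] (0 : ℝ), (g ε).eval r * σ < 0) :
    ∃ f' : ℝ[X], P f' ∧ N + 1 ≤ (f'.roots.toFinset.filter (fun t => 0 < t)).card := by
  classical
  by_cases hN1 : N + 1 ≤ (f.roots.toFinset.filter (fun t => 0 < t)).card
  · exact ⟨f, hPf, hN1⟩
  have hf0 : f ≠ 0 := by rintro rfl; simp at hZm
  -- exactly `N` distinct positive roots
  set R := f.roots.toFinset.filter (fun t => 0 < t) with hR
  have hRN : R.card = N := by omega
  have hmemR : ∀ {z : ℝ}, z ∈ R ↔ f.IsRoot z ∧ 0 < z := by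
    intro z; rw [hR, Finset.mem_filter, Multiset.mem_toFinset, mem_roots hf0]
  -- the multiplicities: exactly one double root `r`, all others simple
  have hsum : ∑ x ∈ R, f.rootMultiplicity x = N + 1 := by
    rw [hR, ← countP_posRoots_eq_sum_rootMultiplicity]; exact hZm
  have hmpos : ∀ x ∈ R, 1 ≤ f.rootMultiplicity x := by
    intro x hx
    exact (rootMultiplicity_pos hf0).mpr (hmemR.mp hx).1
  have hsum' : ∑ x ∈ R, (f.rootMultiplicity x - 1) = 1 := by
    have : ∑ x ∈ R, (f.rootMultiplicity x - 1) + R.card = ∑ x ∈ R, f.rootMultiplicity x := by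
      rw [Finset.card_eq_sum_ones, ← Finset.sum_add_distrib]
      exact Finset.sum_congr rfl fun x hx => Nat.sub_add_cancel (hmpos x hx)
    omega
  obtain ⟨r, hrR, hr1⟩ : ∃ r ∈ R, f.rootMultiplicity r - 1 ≠ 0 := by
    by_contra h
    push Not at h
    rw [Finset.sum_eq_zero h] at hsum'
    exact zero_ne_one hsum'
  have hmr : f.rootMultiplicity r = 2 := by
    have := Finset.single_le_sum (f := fun x => f.rootMultiplicity x - 1) (fun _ _ => Nat.zero_le _) hrR
    rw [hsum'] at this
    have := hmpos r hrR
    omega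
  have hothers : ∀ x ∈ R, x ≠ r → f.rootMultiplicity x = 1 := by
    intro x hx hxr
    have hsub : ({r, x} : Finset ℝ) ⊆ R := by
      intro y hy
      rcases Finset.mem_insert.mp hy with h | h
      · rw [h]; exact hrR
      · rw [Finset.mem_singleton.mp h]; exact hx
    have hle := Finset.sum_le_sum_of_subset_of_nonneg (f := fun x => f.rootMultiplicity x - 1) hsub
      (fun _ _ _ => Nat.zero_le _)
    rw [Finset.sum_pair (Ne.symm hxr), hsum'] at hle
    have := hmpos x hx
    omega
  have hrroot : f.IsRoot r := (hmemR.mp hrR).1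
  have hrpos : 0 < r := (hmemR.mp hrR).2
  have hN0 : 1 ≤ N := by rw [← hRN]; exact Finset.card_pos.mpr ⟨r, hrR⟩
  -- order the `N` roots: `ρ : Fin N ↪o ℝ`, extended to a strictly increasing `ρ' : ℕ → ℝ`
  set ρ : Fin N ↪o ℝ := R.orderEmbOfFin hRN with hρ
  have hρmem : ∀ i, ρ i ∈ R := fun i => Finset.orderEmbOfFin_mem R hRN i
  have hρsurj : ∀ z ∈ R, ∃ i, ρ i = z := by
    intro z hz
    have : z ∈ Set.range ρ := by rw [hρ, Finset.range_orderEmbOfFin]; exact hz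
    exact this
  let ρ' : ℕ → ℝ := fun n => if h : n < N then ρ ⟨n, h⟩ else ρ ⟨N - 1, by omega⟩ + ((n - (N - 1) : ℕ) : ℝ)
  have hρ'mono : StrictMono ρ' := by
    refine strictMono_nat_of_lt_succ fun n => ?_
    by_cases h1 : n + 1 < N
    · have h0 : n < N := by omega
      simp only [ρ', dif_pos h0, dif_pos h1]
      exact ρ.strictMono (Fin.mk_lt_mk.mpr (Nat.lt_succ_self n))
    · by_cases h0 : n < N
      · have hn : n = N - 1 := by omega
        subst hn
        simp only [ρ', dif_pos h0, dif_neg h1]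
        have : (0 : ℝ) < ((N - 1 + 1 - (N - 1) : ℕ) : ℝ) := by
          exact_mod_cast (show 0 < N - 1 + 1 - (N - 1) by omega)
        linarith
      · simp only [ρ', dif_neg h0, dif_neg h1]
        have : ((n - (N - 1) : ℕ) : ℝ) < ((n + 1 - (N - 1) : ℕ) : ℝ) := by
          exact_mod_cast (show n - (N - 1) < n + 1 - (N - 1) by omega)
        linarith
  have hρ'pos : ∀ n, 0 < ρ' n := by
    intro n
    by_cases h0 : n < N
    · simp only [ρ', dif_pos h0]; exact (hmemR.mp (hρmem _)).2
    · simp only [ρ', dif_neg h0]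
      have := (hmemR.mp (hρmem ⟨N - 1, by omega⟩)).2
      positivity
  have hρ'root : ∀ n, n < N → f.IsRoot (ρ' n) := by
    intro n hn; simp only [ρ', dif_pos hn]; exact (hmemR.mp (hρmem _)).1
  have hρ'surj : ∀ z ∈ R, ∃ n, n < N ∧ ρ' n = z := by
    intro z hz
    obtain ⟨i, hi⟩ := hρsurj z hz
    refine ⟨i.val, i.isLt, ?_⟩
    simp only [ρ', dif_pos i.isLt, Fin.eta]; exact hi
  -- the index of the double root
  obtain ⟨j₀, hj₀lt, hj₀⟩ := hρ'surj r hrR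
  -- test points between consecutive roots
  let t : ℕ → ℝ := fun n => if n = 0 then ρ' 0 / 2 else (ρ' (n - 1) + ρ' n) / 2
  have ht_lt : ∀ n, t n < ρ' n := by
    intro n
    by_cases hn : n = 0
    · subst hn; simp only [t, if_true]; linarith [hρ'pos 0]
    · simp only [t, if_neg hn]
      have := hρ'mono (show n - 1 < n by omega)
      linarith
  have ht_gt : ∀ n, ρ' n < t (n + 1) := by
    intro n
    simp only [t, Nat.add_sub_cancel, if_neg (Nat.succ_ne_zero n)]
    have := hρ'mono (Nat.lt_succ_self n)
    linarith
  have ht_pos : ∀ n, 0 < t n := by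
    intro n
    by_cases hn : n = 0
    · subst hn; simp only [t, if_true]; linarith [hρ'pos 0]
    · have := ht_gt (n - 1)
      rw [show n - 1 + 1 = n by omega] at this
      linarith [hρ'pos (n - 1)]
  have ht_mono : StrictMono t := strictMono_nat_of_lt_succ fun n => (ht_lt n).trans (ht_gt n)
  -- root isolation: the only root of `f` in `[t n, t (n+1)]` is `ρ' n`
  have hisol : ∀ n, ∀ z ∈ Set.Icc (t n) (t (n + 1)), f.IsRoot z → z = ρ' n := by
    intro n z hz hfz
    have hzR : z ∈ R := hmemR.mpr ⟨hfz, (ht_pos n).trans_le hz.1⟩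
    obtain ⟨i, hi, hiz⟩ := hρ'surj z hzR
    rw [← hiz]
    rcases lt_trichotomy i n with h | h | h
    · exfalso
      have h1 : ρ' i ≤ ρ' (n - 1) := hρ'mono.monotone (by omega)
      have h2 : ρ' (n - 1) < t n := by
        have := ht_gt (n - 1); rwa [show n - 1 + 1 = n by omega] at this
      linarith [hz.1]
    · rw [h]
    · exfalso
      have h1 : ρ' (n + 1) ≤ ρ' i := hρ'mono.monotone (by omega)
      linarith [hz.2, ht_gt n, ht_lt (n + 1)]
  have ht_ne : ∀ n, f.eval (t n) ≠ 0 := by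
    intro n h0
    have := hisol n (t n) ⟨le_rfl, (ht_mono (Nat.lt_succ_self n)).le⟩ h0
    linarith [ht_lt n]
  -- sign behaviour of `f` across each root
  have hflip : ∀ n, n < N → n ≠ j₀ → f.eval (t n) * f.eval (t (n + 1)) < 0 := by
    intro n hn hnj
    have hm1 : f.rootMultiplicity (ρ' n) = 1 := by
      refine hothers _ (hmemR.mpr ⟨hρ'root n hn, hρ'pos n⟩) ?_
      intro h; rw [← hj₀] at h
      exact hnj (hρ'mono.injective h)
    exact mul_eval_neg_of_rootMultiplicity_eq_one (ht_lt n) (ht_gt n) hm1 (hisol n)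
  have hstay : 0 < f.eval (t j₀) * f.eval (t (j₀ + 1)) := by
    have heven : ∀ z ∈ Set.Ioo (t j₀) (t (j₀ + 1)), f.IsRoot z → Even (f.rootMultiplicity z) := by
      intro z hz hfz
      rw [hisol j₀ z (Set.Ioo_subset_Icc_self hz) hfz, hj₀, hmr]
      exact even_two
    have h := Literature.Algebra.Polynomial.Descartes.mul_eval_nonneg_of_even_rootMultiplicity heven
      (Set.left_mem_Icc.mpr (ht_mono (Nat.lt_succ_self j₀)).le)
      (Set.right_mem_Icc.mpr (ht_mono (Nat.lt_succ_self j₀)).le)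
    exact lt_of_le_of_ne h (Ne.symm (mul_ne_zero (ht_ne _) (ht_ne _)))
  -- the deformation at the double root, against the sign `s = f (t j₀)`
  set s := f.eval (t j₀) with hs
  have hs0 : s ≠ 0 := ht_ne j₀
  obtain ⟨g, hgP, hglim, hgr⟩ := hdef r hrpos hmr s hs0
  -- the deformation keeps the sign of `f` at the `N + 1` test points, for small ε
  have hkeep : ∀ᶠ ε in 𝓝[>] (0 : ℝ), ∀ n ∈ Finset.range (N + 1), 0 < (g ε).eval (t n) * f.eval (t n) := by
    refine (Filter.eventually_all_finset _).mpr fun n _ => ?_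
    have hpos : 0 < f.eval (t n) * f.eval (t n) := mul_self_pos.mpr (ht_ne n)
    exact ((hglim (t n)).mul_const (f.eval (t n))).eventually (lt_mem_nhds hpos)
  -- fix a good ε
  obtain ⟨ε, hεr, hεt⟩ := (hgr.and hkeep).exists
  have hg_t : ∀ n, n < N + 1 → 0 < (g ε).eval (t n) * f.eval (t n) :=
    fun n hn => hεt n (Finset.mem_range.mpr hn)
  refine ⟨g ε, hgP ε, ?_⟩
  -- the `N + 1` sign-change intervals
  let Pn : ℕ → ℝ × ℝ := fun n => (t n, t (n + 1))
  let I : Finset (ℝ × ℝ) := (((Finset.range N).erase j₀).image Pn) ∪ {(t j₀, r), (r, t (j₀ + 1))}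
  have hPinj : Function.Injective Pn := fun m n h => ht_mono.injective (Prod.mk.inj h).1
  have hr_lt : t j₀ < r := by rw [← hj₀]; exact ht_lt j₀
  have hr_gt : r < t (j₀ + 1) := by rw [← hj₀]; exact ht_gt j₀
  have hcard : I.card = N + 1 := by
    rw [Finset.card_union_of_disjoint]
    · rw [Finset.card_image_of_injective _ hPinj, Finset.card_erase_of_mem (Finset.mem_range.mpr hj₀lt),
        Finset.card_range, Finset.card_pair]
      · omega
      · intro h
        have := (Prod.mk.inj h).1
        linarith
    · rw [Finset.disjoint_left]
      intro p hp hp'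
      obtain ⟨n, hn, rfl⟩ := Finset.mem_image.mp hp
      have hnj : n ≠ j₀ := (Finset.mem_erase.mp hn).1
      rcases Finset.mem_insert.mp hp' with h | h
      · exact hnj (ht_mono.injective (Prod.mk.inj h).1)
      · have h2 := (Prod.mk.inj (Finset.mem_singleton.mp h)).1
        exact ht_ne n (h2 ▸ hrroot)
  rw [← hcard]
  refine card_le_card_posRoots_of_signChanges (g ε) I ?_ ?_
  · -- sign changes
    intro p hp
    rcases Finset.mem_union.mp hp with hp | hp
    · obtain ⟨n, hn, rfl⟩ := Finset.mem_image.mp hp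
      obtain ⟨hnj, hnN⟩ := Finset.mem_erase.mp hn
      have hnN := Finset.mem_range.mp hnN
      refine ⟨ht_pos n, ht_mono (Nat.lt_succ_self n), ?_⟩
      have h1 := hg_t n (by omega)
      have h2 := hg_t (n + 1) (by omega)
      have h3 := hflip n hnN hnj
      nlinarith [mul_pos h1 h2]
    · rcases Finset.mem_insert.mp hp with rfl | hp
      · refine ⟨ht_pos j₀, hr_lt, ?_⟩
        have h1 := hg_t j₀ (by omega)
        nlinarith [mul_pos h1 (neg_pos.mpr hεr), mul_self_pos.mpr hs0]
      · rw [Finset.mem_singleton] at hp; subst hp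
        refine ⟨hrpos, hr_gt, ?_⟩
        have h1 := hg_t (j₀ + 1) (by omega)
        nlinarith [mul_pos h1 (neg_pos.mpr hεr), hstay, mul_self_pos.mpr hs0,
          mul_self_pos.mpr (ht_ne (j₀ + 1))]
  · -- separation
    intro p hp q hq hpq
    have hmem : ∀ p ∈ I, (∃ n, n ≠ j₀ ∧ p = (t n, t (n + 1))) ∨ p = (t j₀, r) ∨ p = (r, t (j₀ + 1)) := by
      intro p hp
      rcases Finset.mem_union.mp hp with hp | hp
      · obtain ⟨n, hn, rfl⟩ := Finset.mem_image.mp hp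
        exact Or.inl ⟨n, (Finset.mem_erase.mp hn).1, rfl⟩
      · rcases Finset.mem_insert.mp hp with h | h
        · exact Or.inr (Or.inl h)
        · exact Or.inr (Or.inr (Finset.mem_singleton.mp h))
    have htle : ∀ {m n : ℕ}, m < n → t (m + 1) ≤ t n := fun {m n} h => ht_mono.monotone (by omega)
    rcases hmem p hp with ⟨m, hmj, rfl⟩ | rfl | rfl <;> rcases hmem q hq with ⟨n, hnj, rfl⟩ | rfl | rfl
    · rcases lt_trichotomy m n with h | h | h
      · exact Or.inl (htle h)
      · exact absurd (by rw [h]) hpq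
      · exact Or.inr (htle h)
    · rcases lt_or_gt_of_ne hmj with h | h
      · exact Or.inl (htle h)
      · exact Or.inr (hr_gt.le.trans (htle h))
    · rcases lt_or_gt_of_ne hmj with h | h
      · exact Or.inl ((htle h).trans hr_lt.le)
      · exact Or.inr (htle h)
    · rcases lt_or_gt_of_ne hnj with h | h
      · exact Or.inr (htle h)
      · exact Or.inl (hr_gt.le.trans (htle h))
    · exact absurd rfl hpq
    · exact Or.inl le_rfl
    · rcases lt_or_gt_of_ne hnj with h | h
      · exact Or.inr ((htle h).trans hr_lt.le)
      · exact Or.inl (htle h)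
    · exact Or.inr le_rfl
    · exact absurd rfl hpq

end Summit.ValiantsHypothesis.ValiantsHypothesis.Theorems.LacunarySymmetroidMatrixDescartes.Census
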